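import Literature.MathematicalPhysics.QuantumFieldTheory.BalabanImbrieJaffe1984to88.BIJ88Sect4Statements
import Literature.MathematicalPhysics.QuantumFieldTheory.Balaban1983to89.B5Eq118OneStroke
import Literature.MathematicalPhysics.QuantumFieldTheory.Balaban1983to89.B15DeterminingSets

/-!
# `BalabanImbrieJaffe1984to88.BIJ88Eq44OneStroke` — T. Bałaban, J. Imbrie, A. Jaffe, *Effective action and cluster properties of
the abelian Higgs model*, Commun. Math. Phys. **114** (1988) 257–315 [BalabanImbrieJaffe1988], (4.4) p. 274 [PDF 18]: **the typed
`k`-fold iterate `BIJ88Sect4Statements.barU` IS the printed "product along the bond in T₁^{(k)}" — the one-stroke formula for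
`ū_k`, PROVED** (any gauge group; abelian reading for C2's `U(1)` model).

statement-level skeleton of published theorems with citation tags; proofs where landed; nothing here is a claim about the Yang–Mills mass gap

PDF held: `paper:balaban1988-cmp114-bij-abelian-higgs-effective-action` (journal page = PDF page + 256); p. 274 [PDF 18] read as an image
(poppler ×2.4 render `renders/c2-p018.png` of the r18 gen-5 seat folder; HOME copy of r16's ×2 render
`lit-balaban-r16/renders/cmp114/original-p018-x2.png`).

CITATION HEADER (lean-in-tree rule).  Part of the lit-balaban TYPED SKELETON (HOME `run/shared/lean/pub/lit-balaban/`): row `C2.Eq4.4`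
of `HOME/lit-balaban-r18/ROWS-C2.md` (decl of record `BIJ88Sect4Statements.barU`, typed p240556: *"one level = the tree's
`AveragingRT.axialAvg`; k-fold iterate typed"*); unit `lit-balaban-r18` (READER/TYPER r18: cross-paper DEFINITIONS — averaging
operators, block fields; fold owner of C2 Sects. 1–4), gen 5.  Register rows of `HOME/lit-balaban-r18/SKELETON-r18.md` served:
A02/A04-type knitting (one-stroke formulas) for the MULTIPLICATIVE straight-line average (the additive one, B5 (1.18), is p39's
`B5Eq118OneStroke`).

THE PRINT (p. 274 [PDF 18], verbatim).  *"The configuration u_k on T_η gives a configuration ū_k on T₁^{(k)} by taking a product along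
the bond in T₁^{(k)}, i.e., ū_{k,b} = u_k(⟨b₋, b₊⟩). (4.4)"*

CARRIERS (all of record; nothing re-declared).  `Balaban1983to89.Setup`: the η-lattice `T_η = T^{(0)}` (`Site P 0`, bonds `PBond P 0`,
`GaugeField P 0 G`), the unit lattice `T₁^{(k)} = T^{(k)}`; the centre embedding `emb : T^{(j+1)} → T^{(j)}` and its iterate
`B15DeterminingSets.embIter k : T^{(k)} → T_η` (the centre of the block `B^k(y)`); the straight runs `LatticeFieldCalculus.runSite`
(`x + s e_μ`); the one-level straight-line transport `AveragingRT.axialAvg` (`ū(c) = Π_{t<L} u(line c t)`, `line c t` = the `t`-th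
bond from the centre of `B(c₋)` towards the centre of `B(c₊)`) and its `k`-fold iterate `BIJ88Sect4Statements.barU k`.  CONVENTION
(inherited, flagged): `Setup` anchors blocks at their CENTRES (B12 (0.1)/(0.3), `L` odd; cell DIVERGENCE F3), so the unit-lattice bond
`⟨b₋, b₊⟩` is read in `T_η` as the straight line of `L^k` η-bonds between the centres of `B^k(b₋)` and `B^k(b₊)`; [2]/[BalabanImbrieJaffe1988]
anchor at corners — the formula is insensitive to the anchor.

WHAT IS PROVED (kernel-checked, 0 sorry, standard axioms; no `Prop`-valued fact and no new notion is introduced — the only new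
declarations are theorems and two private list-product plumbing lemmas).
* §1 the centre embeddings intertwine translations, scaling the step: `emb (y + e_μ) = emb y + L e_μ` (`emb_shift`, torus wrap-around by
  `AveragingRT.cast_succ_mul_L`), `emb (y + t e_μ) = emb y + tL e_μ` (`emb_runSite`), **`embIter k (y + t e_μ) = embIter k y + tL^k e_μ`**
  (`embIter_runSite`, standing range `k ≤ m + K`) — so the end of the run of `L^k` η-bonds from the centre of `B^k(b₋)` is the centre of
  `B^k(b₊)` (`runSite_embIter_tgt`);
* §3 **(4.4)** `barU_eq_lineProd`: for every gauge group `G`, every `u : GaugeField P 0 G`, every `k ≤ m + K` and every bond `b` of `T^{(k)}`,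
  `barU k u b = Π_{s<L^k} u ⟨embIter k b₋ + s e_μ, μ⟩` as an ORDERED product (`((List.range (L^k)).map …).prod`), `μ` the direction of
  `b` — induction on `k`: `barU (k+1) u b = Π_{t<L} (barU k u)(line b t)` (`barU_succ`, definitional), each factor is by induction the
  ordered product over the `L^k` η-bonds from `embIter k (lineSite b t) = embIter (k+1) b₋ + tL^k e_μ` (§1), and `L` consecutive runs of
  `L^k` bonds make one run of `L^{k+1}` bonds (private `prod_range_mul`, the multiplicative analogue of p39's `segSum_mul`);
  `barU_one : barU 1 = axialAvg` and `barU_succ` record the recursion;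
* §4 the abelian reading for C2's model: `toC_barU` — for `u : GaugeField P 0 U1`, `toC (barU k u b) = ∏_{s<L^k} toC (u ⟨…⟩)` as a
  `Finset` product in `ℂ` (the language of `BIJ88Sect3Statements.cfg`).
NOT DONE HERE (honest scope).  The corner-anchored variant (product from the corner of `B^k(b₋)`; it differs from the centred one by a
conjugation-free relabelling of the line and is what [2] (2.10)'s `u(Γ_{yy′})` iterates — r18 gen 4's `BIJ85BlockAveragesTorus.runC` is
its one-level form); gauge covariance of `ū_k` (one level: `AveragingRT.pathProd_gaugeAct`).  presearch (r18 gen 5): the additive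
one-stroke formula B5 (1.18) is p39's `B5Eq118OneStroke.eq118` [corpus: paper:balaban1984-cmp95-propagators-rt-i p.20]; no separate
printed source for the multiplicative display beyond (4.4) itself and [2] (2.10).
-/

namespace Literature.MathematicalPhysics.QuantumFieldTheory.BalabanImbrieJaffe1984to88.BIJ88Eq44OneStroke

open Literature.MathematicalPhysics.QuantumFieldTheory.Balaban1983to89
open LatticeFieldCalculus (runSite runSite_zero runSite_succ)
open B5Eq118OneStroke (runSite_add)
open B15DeterminingSets (embIter)
open BIJ88Sect4Statements (barU)
open AveragingRT (axialAvg pathProd line lineSite cast_succ_mul_L)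
open BIJ88Sect3Statements (U1 toC toC_mul toC_one)
open scoped BigOperators

variable {P : Params} {j : ℕ} {G : Type*} [GaugeGroup G]

/-! ## §1 The centre embeddings `T^{(j+1)} ⊂ T^{(j)} ⊂ … ⊂ T_η` intertwine translations (scaling the step by `L`) -/

/-- kernel: `emb (y + e_μ) = emb y + L e_μ` — one step of the `L^{j+1}η`-lattice is `L` steps of the `L^jη`-lattice under the
centre embedding (standing range; torus wrap-around via `AveragingRT.cast_succ_mul_L`). [cite: BalabanImbrieJaffe1988, (4.4) p.274] -/
theorem emb_shift (hj : j + 1 ≤ P.m + P.K) (y : Balaban1983to89.Site P (j+1)) (μ : Fin P.d) :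
    emb (y.shift μ) = runSite (emb y) μ P.L := by
  funext ν
  by_cases hν : ν = μ
  · subst hν
    simp only [emb, Balaban1983to89.Site.shift, Function.update_self, runSite]
    rw [cast_succ_mul_L hj]
    push_cast
    ring
  · simp only [emb, Balaban1983to89.Site.shift, Function.update_of_ne hν, runSite]

/-- kernel: `emb (y + t e_μ) = emb y + tL e_μ`. [cite: BalabanImbrieJaffe1988, (4.4) p.274] -/
theorem emb_runSite (hj : j + 1 ≤ P.m + P.K) (y : Balaban1983to89.Site P (j+1)) (μ : Fin P.d) :
    ∀ t : ℕ, emb (runSite y μ t) = runSite (emb y) μ (t * P.L)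
  | 0 => by simp
  | t + 1 => by
    rw [runSite_succ, emb_shift hj, emb_runSite hj y μ t, runSite_add, Nat.succ_mul]

/-- **`x(b)`-type translation covariance of the iterated centre embedding**: `embIter k (y + t e_μ) = embIter k y + tL^k e_μ` —
a step of the unit lattice `T₁^{(k)}` is `L^k` steps of `T_η` (standing range `k ≤ m + K`). [cite: BalabanImbrieJaffe1988, (4.4) p.274] -/
theorem embIter_runSite : ∀ (k : ℕ), k ≤ P.m + P.K → ∀ (y : Balaban1983to89.Site P k) (μ : Fin P.d) (t : ℕ),
    embIter k (runSite y μ t) = runSite (embIter k y) μ (t * P.L ^ k)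
  | 0, _, y, μ, t => by simp [embIter]
  | k + 1, hk, y, μ, t => by
    show embIter k (emb (runSite y μ t)) = runSite (embIter k (emb y)) μ (t * P.L ^ (k + 1))
    rw [emb_runSite hk, embIter_runSite k (by omega), show t * P.L * P.L ^ k = t * P.L ^ (k + 1) by ring]

/-! ## §2 Ordered products along concatenated runs -/

/-- kernel (plumbing): an ordered product over `n·m` consecutive indices is the ordered product of `n` ordered products over
`m` consecutive indices each. [folklore] -/
private theorem prod_range_mul {M : Type*} [Monoid M] (g : ℕ → M) (m : ℕ) : ∀ n : ℕ,
    ((List.range (n * m)).map g).prod =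
      ((List.range n).map fun t => ((List.range m).map fun s => g (t * m + s)).prod).prod
  | 0 => by simp
  | n + 1 => by
    rw [Nat.succ_mul, List.range_add, List.map_append, List.prod_append, prod_range_mul g m n, List.range_succ,
      List.map_append, List.prod_append, List.map_singleton, List.prod_singleton, List.map_map]
    rfl

/-- kernel (plumbing): `AveragingRT.pathProd` (the one-level straight-line transport) as an ordered list product. [folklore] -/
private theorem pathProd_eq_prod (U : GaugeField P j G) (c : PBond P (j+1)) :
    ∀ n : ℕ, pathProd U c n = ((List.range n).map fun t => U (line c t)).prod
  | 0 => by simp [pathProd]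
  | n + 1 => by
    rw [pathProd, pathProd_eq_prod U c n, List.range_succ, List.map_append, List.prod_append, List.map_singleton,
      List.prod_singleton]

/-! ## §3 (4.4): the typed `k`-fold iterate `barU` IS the printed product along the bond of `T₁^{(k)}` -/

/-- **(4.4)** p. 274 [PDF 18], verbatim: *"The configuration u_k on T_η gives a configuration ū_k on T₁^{(k)} by taking a product
along the bond in T₁^{(k)}, i.e., ū_{k,b} = u_k(⟨b₋, b₊⟩). (4.4)"* — PROVED for the decl of record `BIJ88Sect4Statements.barU`
(the `k`-fold iterate of the one-level straight-line product `AveragingRT.axialAvg` from the η-lattice `T^{(0)} = T_η` to `T^{(k)}`):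
for every gauge group, every `u : T_η`-bond field and every bond `b = ⟨y, y + e_μ⟩` of `T₁^{(k)}`,
`barU k u b = u(x₀x₁)·u(x₁x₂)⋯u(x_{L^k−1}x_{L^k})` (ORDERED product), `x_s = x + s·ηe_μ`, `x = embIter k y` the centre of
`B^k(y)` in `T_η` and `x_{L^k}` the centre of `B^k(y + e_μ)` (`embIter_runSite`) — the parallel transport of `u_k` along the
straight line of `L^k` η-bonds that constitutes the unit-lattice bond `⟨b₋, b₊⟩` (centred-block convention of `Setup`,
DIVERGENCE F3; standing range `k ≤ m + K`). [cite: BalabanImbrieJaffe1988, (4.4) p.274] -/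
theorem barU_eq_lineProd : ∀ (k : ℕ), k ≤ P.m + P.K → ∀ (U : GaugeField P 0 G) (b : PBond P k),
    barU k U b = ((List.range (P.L ^ k)).map fun s => U ⟨runSite (embIter k b.src) b.dir s, b.dir⟩).prod
  | 0, _, U, b => by
    cases b with
    | mk x μ => simp [barU, embIter]
  | k + 1, hk, U, b => by
    show axialAvg (barU k U) b = _
    unfold axialAvg
    rw [pathProd_eq_prod, pow_succ', prod_range_mul]
    congr 1
    refine List.map_congr_left fun t _ => ?_
    rw [barU_eq_lineProd k (by omega) U (line b t)]
    have e1 : (line b t).src = runSite (emb b.src) b.dir t := rfl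
    have e2 : (line b t).dir = b.dir := rfl
    rw [e1, e2, embIter_runSite k (by omega)]
    congr 1
    refine List.map_congr_left fun s _ => ?_
    rw [runSite_add]
    rfl

/-- **(4.4), end-points**: the run of `L^k` η-bonds of `barU k u ⟨y, y + e_μ⟩` starts at the centre `embIter k y` of `B^k(b₋)` and
ENDS at the centre `embIter k (y + e_μ)` of `B^k(b₊)` — it is the bond `⟨b₋, b₊⟩` of the unit lattice read in `T_η`.
[cite: BalabanImbrieJaffe1988, (4.4) p.274] -/
theorem runSite_embIter_tgt {k : ℕ} (hk : k ≤ P.m + P.K) (b : PBond P k) :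
    runSite (embIter k b.src) b.dir (P.L ^ k) = embIter k b.tgt := by
  have e : b.tgt = runSite b.src b.dir 1 := by
    rw [show (1 : ℕ) = 0 + 1 from rfl, runSite_succ, runSite_zero]
    rfl
  rw [e, embIter_runSite k hk, one_mul]

/-- **(4.4) for one level** (`k = 1`): `ū_{1,b}` is `AveragingRT.axialAvg u b`, the transport along the `L` η-bonds from the centre of
`B(b₋)` to the centre of `B(b₊)`. [cite: BalabanImbrieJaffe1988, (4.4) p.274] -/
theorem barU_one (U : GaugeField P 0 G) : barU 1 U = axialAvg U := rfl

/-- **(4.4), recursion**: `ū_{k+1} = (ū_k)‾` — one more level is one more straight-line product. [cite: BalabanImbrieJaffe1988, (4.4) p.274] -/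
theorem barU_succ (k : ℕ) (U : GaugeField P 0 G) : barU (k + 1) U = axialAvg (barU k U) := rfl

/-! ## §4 The abelian reading (C2's `U(1)` model): the ordered product is the ordinary product of the bond variables -/

/-- kernel (plumbing): `toC : U(1) → ℂ` is multiplicative on lists. [folklore] -/
private theorem toC_list_prod : ∀ l : List U1, toC l.prod = (l.map toC).prod
  | [] => by simp [toC_one]
  | g :: l => by rw [List.prod_cons, toC_mul, toC_list_prod l, List.map_cons, List.prod_cons]

/-- kernel (plumbing): in a commutative monoid an ordered product over `range n` is the `Finset` product. [folklore] -/
private theorem list_prod_range_eq {M : Type*} [CommMonoid M] (f : ℕ → M) :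
    ∀ n : ℕ, ((List.range n).map f).prod = ∏ s ∈ Finset.range n, f s
  | 0 => by simp
  | n + 1 => by
    rw [List.range_succ, List.map_append, List.prod_append, List.map_singleton, List.prod_singleton, list_prod_range_eq f n,
      Finset.prod_range_succ]

/-- **(4.4) in the abelian Higgs model of C2** (`u` a `U(1)`-valued bond field on `T_η`, values read in `ℂ` by
`BIJ88Sect3Statements.toC`, i.e. the `cfg` of Sect. 3): `ū_{k,b} = Π_{s<L^k} u(⟨x + s·ηe_μ, x + (s+1)·ηe_μ⟩)`, `x = embIter k b₋`,
as an ordinary product of complex numbers of modulus one. [cite: BalabanImbrieJaffe1988, (4.4) p.274] -/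
theorem toC_barU {k : ℕ} (hk : k ≤ P.m + P.K) (U : GaugeField P 0 U1) (b : PBond P k) :
    toC (barU k U b) = ∏ s ∈ Finset.range (P.L ^ k), toC (U ⟨runSite (embIter k b.src) b.dir s, b.dir⟩) := by
  rw [barU_eq_lineProd k hk U b, toC_list_prod, List.map_map, ← list_prod_range_eq]
  rfl

end Literature.MathematicalPhysics.QuantumFieldTheory.BalabanImbrieJaffe1984to88.BIJ88Eq44OneStroke
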